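import Literature.NumberTheory.Sieve.ChenTwin
import Literature.NumberTheory.Sieve.ChenTwinTheoremIIHolds
import Literature.NumberTheory.Sieve.HeathBrownCubicPrimes
import Literature.NumberTheory.Sieve.HeathBrownCubicPrimesHolds
import HarnessLib

/-!
# Discharges of named facts of `ParityWave0.lean`

`Literature/NumberTheory/Sieve/ParityWave0Holds.lean` — proofs-only sibling of
`ParityWave0.lean` (no definitions, no named facts). Each theorem below closes a named fact `X
: Prop` of that file as `X_holds : X` by composing an ACCEPTED reduction theorem of the tree
with the ACCEPTED unconditional `_holds` discharges of all of its hypotheses; nothing is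
re-proved and no statement is changed. Recorded by the librarian sweep g25 (2026-08-16, pass
5c: facts dischargeable in one line from the tree's own lemmas), so that the facts census,
`#h21_route_deps` and the cone guardrail see these facts as theorems.

Discharged here:

* `setOf_prime_cube_add_two_mul_cube_infinite_holds` :=
  `setOf_prime_cube_add_two_mul_cube_infinite_of_heathBrown2001`
  `HeathBrown2001_primePairCount_asymptotic_holds` (`HeathBrownCubicPrimes.lean`).
* `chen_twin_holds` := `chen_twin_of_theoremII` `Chen1973_theoremII_holds` (`ChenTwin.lean`).

## References

* [ChenSciSinica1973] — see `lean/references.bib` and the docstring of the fact in `ParityWave0.lean`.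
* [HeathBrownActa2001] — see `lean/references.bib` and the docstring of the fact in `ParityWave0.lean`.
-/

namespace Literature.NumberTheory.Sieve

/-- **Discharge of the named fact `setOf_prime_cube_add_two_mul_cube_infinite`**
(`ParityWave0.lean`): parity.S18 (Heath-Brown, Acta Math. 186 (2001), Thm 1). There are
infinitely many primes of the form `x³ + 2y³` with `x, y` positive integers. — obtained as
`setOf_prime_cube_add_two_mul_cube_infinite_of_heathBrown2001` applied to the tree's
unconditional discharge `HeathBrown2001_primePairCount_asymptotic_holds` of its hypothesis
(reduction in `HeathBrownCubicPrimes.lean`).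
[cite: HeathBrownActa2001, Theorem 1] -/
theorem setOf_prime_cube_add_two_mul_cube_infinite_holds :
    setOf_prime_cube_add_two_mul_cube_infinite :=
  setOf_prime_cube_add_two_mul_cube_infinite_of_heathBrown2001
    Literature.NumberTheory.Sieve.CubicPrimes.HeathBrown2001_primePairCount_asymptotic_holds

/-- **Discharge of the named fact `chen_twin`** (`ParityWave0.lean`): parity.S12 (Chen's theorem,
twin form; Chen, Sci. Sinica 16 (1973); Halberstam–Richert ch. 11). There are infinitely many
primes `p` with `p + 2 ∈ P₂`. — obtained as `chen_twin_of_theoremII` applied to the tree's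
unconditional discharge `Chen1973_theoremII_holds` of its hypothesis (reduction in
`ChenTwin.lean`).
[cite: ChenSciSinica1973, Theorem 2; Halberstam–Richert Ch. 11] -/
theorem chen_twin_holds :
    chen_twin :=
  chen_twin_of_theoremII Literature.NumberTheory.Sieve.Chen.Chen1973_theoremII_holds

end Literature.NumberTheory.Sieve
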